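import Summits.Parity.GeneralizedHardyLittlewood.Theorems.LeeYangFibresAbsoluteUpgradeModGammaAssemblyAux
import Summits.Parity.GeneralizedHardyLittlewood.Theorems.LeeYangFibresAbsoluteUpgradeDipDefs
import HarnessLib

/-!
# `ModGammaDisc` from the adjoint method (crux stmt-Parity-14116, line `dip-margin-rate-exchange`, lead seat c1)

The ASSEMBLY of the registered stub `stub_modGammaDisc` from the analytic inputs of the adjoint method
(vocabulary `LeeYangFibresAbsoluteUpgradeModGammaDefs.lean`; pieces in `…ModGammaAssemblyAux.lean`):

* `MGAdjointAsymp` — Watson: `v g̃_z(v) = e^{γz} v^{−z} (1 + O(1/v))` uniformly on `|z| ≤ N − 1`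
  (`g̃ = adjTilde N z`, the regularised `Γ`-normalised adjoint);
* `MGInvariantValue` and `MGInvariantConst` — along the row `K = rowFn u z`,
  `v K(v) g̃(v) + z ∫_{v−1}^{v} K(t) g̃(t+1) dt = 1/Γ(1+z)` for `1 ≤ v ≤ u − 1`
  (`MGAdjointEq`, `(v g̃)' = −z g̃(v+1)`, enters only through the proofs of these and is not a hypothesis here).

Proof (`modGammaDisc_of_adjoint`, registered). Fix `K`, put `N = K + 2`. (i) CONTINUOUS INDUCTION
(`apriori_bound`) applied to `M(t) = |K(t)| t^{−Re z}`: the invariant and Watson give the contracting window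
estimate `M(v) ≤ A₁ + ½ sup_{[v−1,v]} M` for `v ≥ v₁(K)`, whence the a-priori bound `|K_z(v)| ≤ A v^{Re z}` on
`[v₁ − 1, u − 1]` with `A` depending on `K` only (initial window by `|K_z(t)| ≤ (t+1)^{|z|}`). (ii) Dividing the
invariant by `v g̃(v)` (`|v g̃| ≥ ½|e^{γz}v^{−z}|`) gives `K(v) = e^{−γz} v^{z}/Γ(1+z) + O(v^{Re z}/v)`; at
`v = u − 1` this is `ModGammaDisc` (`K(u−1) = modelEval u u z = Σ_{j<u} I_{j+1}(u) z^j`, `modGamma_convert`).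
-/

noncomputable section

namespace Summit.Parity.GeneralizedHardyLittlewood.Cruxes.AbsoluteUpgrade.DipMarginRateExchange

open scoped BigOperators
open MeasureTheory Set Filter
open scoped Interval
open Summit.Parity.GeneralizedHardyLittlewood.Cruxes.ModelHyperbolicity.WindowChainTransport
  (cellDensity modelEval stub_calculus)

/-! ## Conversions -/


/-- Crude bound for the weighted row on the initial window `[v₁−1, v₁]`:
`|K(x)| x^{−Re z} ≤ (v₁+1)^R (v₁+1)^R` for `‖z‖ ≤ R`, `v₁ ≥ 2`. -/
theorem rowFn_weighted_le (u : ℕ) (z : ℂ) {R v₁ x : ℝ} (hzR : ‖z‖ ≤ R) (hre : -R ≤ z.re)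
    (hv₁ : 2 ≤ v₁) (hx : x ∈ Icc (v₁ - 1) v₁) :
    ‖rowFn u z x‖ * x ^ (-z.re) ≤ (v₁ + 1) ^ R * (v₁ + 1) ^ R := by
  have hR0 : 0 ≤ R := (norm_nonneg z).trans hzR
  have hx1 : (1 : ℝ) ≤ x := by linarith [hx.1]
  have hx0 : 0 < x := by linarith
  have hK1 : ‖rowFn u z x‖ ≤ (v₁ + 1) ^ R := by
    calc ‖rowFn u z x‖ ≤ (x + 1) ^ ‖z‖ := rowFn_norm_le u z hx0.le
      _ ≤ (v₁ + 1) ^ ‖z‖ := Real.rpow_le_rpow (by linarith) (by linarith [hx.2]) (norm_nonneg _)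
      _ ≤ (v₁ + 1) ^ R := Real.rpow_le_rpow_of_exponent_le (by linarith) hzR
  have hK2 : x ^ (-z.re) ≤ (v₁ + 1) ^ R := by
    calc x ^ (-z.re) ≤ x ^ R := Real.rpow_le_rpow_of_exponent_le hx1 (by linarith)
      _ ≤ (v₁ + 1) ^ R := Real.rpow_le_rpow hx0.le (by linarith [hx.2]) hR0
  exact mul_le_mul hK1 hK2 (Real.rpow_nonneg hx0.le _) (by positivity)

/-- Conversion of the adjoint-method conclusion (about `rowFn u z (u−1)` and `E(u−1) = e^{γz}(u−1)^{−z}`)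
to the quantities of `ModGammaDisc`. -/
theorem modGamma_convert (u : ℕ) (z : ℂ) {Cfin : ℝ} (hu : (2 : ℝ) ≤ (u : ℝ)) (hCfin : 0 ≤ Cfin)
    (h : ‖rowFn u z ((u : ℝ) - 1) - (Complex.Gamma (1 + z))⁻¹ *
        (Complex.exp ((Real.eulerMascheroniConstant : ℂ) * z) * ((((u : ℝ) - 1 : ℝ) : ℂ) ^ (-z)))⁻¹‖ ≤
        Cfin * (((u : ℝ) - 1) ^ z.re / ((u : ℝ) - 1))) :
    ‖(∑ j ∈ Finset.range u, (cellDensity j u : ℂ) * z ^ j) -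
        Complex.exp (-(Real.eulerMascheroniConstant : ℂ) * z) * (((u : ℂ) - 1) ^ z) /
          Complex.Gamma (1 + z)‖ ≤
      2 * Cfin / u * ‖((u : ℂ) - 1) ^ z‖ := by
  set v : ℝ := (u : ℝ) - 1 with hv
  have hv0 : 0 < v := by rw [hv]; linarith
  have hvc : ((u : ℂ) - 1) = (v : ℂ) := by rw [hv]; push_cast; ring
  have hsum : (∑ j ∈ Finset.range u, (cellDensity j u : ℂ) * z ^ j) = rowFn u z v := by
    simp only [rowFn, modelEval]
    have : v + 1 = (u : ℝ) := by rw [hv]; ring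
    rw [this]
  have hmodel : Complex.exp (-(Real.eulerMascheroniConstant : ℂ) * z) * (((u : ℂ) - 1) ^ z) /
      Complex.Gamma (1 + z) = (Complex.Gamma (1 + z))⁻¹ *
        (Complex.exp ((Real.eulerMascheroniConstant : ℂ) * z) * ((v : ℂ) ^ (-z)))⁻¹ := by
    rw [hvc]
    simp only [mul_inv, Complex.cpow_neg, inv_inv, ← Complex.exp_neg, neg_mul]
    ring
  have hnormv : ‖((u : ℂ) - 1) ^ z‖ = v ^ z.re := by
    rw [hvc, Complex.norm_cpow_eq_rpow_re_of_pos hv0]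
  rw [hsum, hmodel, hnormv]
  have huR : (0 : ℝ) < (u : ℝ) := by linarith
  calc _ ≤ Cfin * (v ^ z.re / v) := h
    _ ≤ Cfin * (v ^ z.re * (2 / (u : ℝ))) := by
        rw [div_eq_mul_inv]
        gcongr
        rw [inv_eq_one_div, div_le_div_iff₀ hv0 huR, hv]; linarith
    _ = 2 * Cfin / (u : ℝ) * v ^ z.re := by ring

/-! ## The assembly -/

/-- **`ModGammaDisc` from the adjoint method.** With `N = K+2`, `K = rowFn u z`, `g = adjTilde N z` and
`E(w) = e^{γz} w^{−z}`: the invariant (`MGInvariantConst` + `MGInvariantValue`) reads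
`K(w)·(w g(w)) + z∫_{w−1}^{w} K g(·+1) = 1/Γ(1+z)`; Watson (`MGAdjointAsymp`) gives `½|E| ≤ |w g(w)| ≤ 2|E|`
for `w ≥ v₁`; the window step `window_step` then contracts (`M(w) ≤ A₁ + S/2` when `M ≤ S` on `[w−1,w]`,
`M(t) = |K(t)| t^{−Re z}`), so continuous induction (`apriori_bound`) bounds `M` on `[v₁−1, u−1]`, and the
final division `final_step` at `w = u − 1` gives `|K(u−1) − e^{−γz}(u−1)^{z}/Γ(1+z)| ≤ (C/u)|(u−1)^z|`,
uniformly for `‖z‖ ≤ K+1`. [cite: Greaves2001, §4.2] -/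
theorem modGammaDisc_of_adjoint : MGAdjointAsymp → MGInvariantValue → MGInvariantConst → ModGammaDisc := by
  intro hAs hVal hConst K
  -- parameters
  set N : ℕ := K + 2 with hN
  have hN1 : 1 ≤ N := by omega
  have hNR : ((N : ℝ) - 1) = (K : ℝ) + 1 := by simp [hN]; ring
  obtain ⟨Ca, va, hva, hAsy⟩ := hAs N hN1
  set γ : ℝ := Real.eulerMascheroniConstant with hγ
  set R : ℝ := (K : ℝ) + 1 with hR
  have hR0 : 0 ≤ R := by positivity
  obtain ⟨CΓ, hCΓ0, hCΓ⟩ := norm_GammaInv_le_of_norm_le R hR0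
  -- constants
  set C₁ : ℝ := max Ca 0 * Real.exp (γ * R) with hC₁
  have hC₁0 : 0 ≤ C₁ := by positivity
  set C₂ : ℝ := 2 * R * 2 ^ (K + 1) with hC₂
  have hC₂0 : 0 ≤ C₂ := by positivity
  set A₁ : ℝ := 2 * CΓ * Real.exp (γ * R) with hA₁
  have hA₁0 : 0 ≤ A₁ := by positivity
  -- the threshold `v₁` beyond which `|w g̃| ≥ ½ |E|` and the induction contracts
  set v₁ : ℝ := max (max va 3) (max (2 * C₁ + 1) (4 * C₂ + 1)) with hv₁
  have hv₁a : va ≤ v₁ := le_trans (le_max_left _ _) (le_max_left _ _)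
  have hv₁3 : (3 : ℝ) ≤ v₁ := le_trans (le_max_right _ _) (le_max_left _ _)
  have hv₁C₁ : 2 * C₁ + 1 ≤ v₁ := le_trans (le_max_left _ _) (le_max_right _ _)
  have hv₁C₂ : 4 * C₂ + 1 ≤ v₁ := le_trans (le_max_right _ _) (le_max_right _ _)
  -- the a-priori constant and the final constant
  set B₀ : ℝ := (v₁ + 1) ^ R * (v₁ + 1) ^ R with hB₀
  set Abig : ℝ := max (B₀ / (2 * A₁ + 1) + 1) 2 * (2 * A₁ + 1) with hAbig
  have hAbig0 : 0 ≤ Abig := by positivity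
  set Cfin : ℝ := 2 * CΓ * C₁ * Real.exp (γ * R) + 2 * C₂ * Abig with hCfin
  have hCfin0 : 0 ≤ Cfin := by positivity
  refine ⟨2 * Cfin, ⌈v₁⌉₊ + 2, fun u hu z hz => ?_⟩
  -- numerics about `z`, `u`, `v = u - 1`
  have hzR : ‖z‖ ≤ R := hz
  have hzN : ‖z‖ ≤ (N : ℝ) - 1 := by rw [hNR]; exact hz
  have hre : |z.re| ≤ R := (Complex.abs_re_le_norm z).trans hzR
  have hre1 : -R ≤ z.re := (abs_le.mp hre).1
  have hreK : -((K : ℝ) + 1) ≤ z.re := hre1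
  have hγ0 : 0 ≤ γ := le_of_lt (lt_trans (by norm_num) Real.one_half_lt_eulerMascheroniConstant)
  have hea : Real.exp (-(γ * z.re)) ≤ Real.exp (γ * R) := by
    apply Real.exp_le_exp.mpr; nlinarith
  have hee : (1 : ℝ) ≤ Real.exp (γ * R) * Real.exp (γ * z.re) := by
    rw [← Real.exp_add]
    apply Real.one_le_exp
    nlinarith
  have huv₁ : v₁ + 2 ≤ (u : ℝ) := by
    have h1 : ((⌈v₁⌉₊ + 2 : ℕ) : ℝ) ≤ (u : ℝ) := by exact_mod_cast hu
    push_cast at h1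
    linarith [Nat.le_ceil v₁]
  have hu3 : (3 : ℕ) ≤ u := by
    have : (3 : ℝ) ≤ (u : ℝ) := by linarith
    exact_mod_cast this
  set v : ℝ := (u : ℝ) - 1 with hv
  have hvv₁ : v₁ + 1 ≤ v := by rw [hv]; linarith
  have hv1 : (1 : ℝ) ≤ v := by linarith
  have hv0 : (0 : ℝ) < v := by linarith
  -- abbreviations
  set Kf : ℝ → ℂ := rowFn u z with hKf
  set g : ℝ → ℂ := adjTilde N z with hg
  set E : ℝ → ℂ := fun w => Complex.exp ((Real.eulerMascheroniConstant : ℂ) * z) * ((w : ℂ) ^ (-z))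
    with hE
  -- norms of the model quantities
  have hexp : ‖Complex.exp ((Real.eulerMascheroniConstant : ℂ) * z)‖ = Real.exp (γ * z.re) := by
    rw [Complex.norm_exp]
    simp [hγ]
  have hEnorm' : ∀ w : ℝ, ‖E w‖ = Real.exp (γ * z.re) * ‖((w : ℂ) ^ (-z))‖ := by
    intro w
    simp only [hE, norm_mul, hexp]
  have hEnorm : ∀ w : ℝ, 0 < w → ‖E w‖ = Real.exp (γ * z.re) * w ^ (-z.re) := by
    intro w hw
    rw [hEnorm' w, Complex.norm_cpow_eq_rpow_re_of_pos hw]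
    simp
  -- Watson: `‖w g w - E w‖ ≤ (C₁/w) ‖E w‖`, hence `½‖E‖ ≤ ‖w g w‖ ≤ 2‖E‖` for `w ≥ v₁`
  have hWat : ∀ w : ℝ, v₁ ≤ w → ‖(w : ℂ) * g w - E w‖ ≤ C₁ / w * ‖E w‖ := by
    intro w hw
    have hw0 : 0 < w := by linarith
    rw [hEnorm' w]
    exact watson_relerr hw0 (norm_nonneg _) (hAsy w (le_trans hv₁a hw) z hzN) hee
  have hGbounds : ∀ w : ℝ, v₁ ≤ w →
      ‖E w‖ / 2 ≤ ‖(w : ℂ) * g w‖ ∧ ‖(w : ℂ) * g w‖ ≤ 2 * ‖E w‖ := by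
    intro w hw
    have hw0 : 0 < w := by linarith
    refine norm_bounds_of_rel_err (hWat w hw) ?_
    rw [div_le_iff₀ hw0]; linarith
  -- `‖g (t+1)‖ ≤ 2 e^{γ Re z} (t+1)^{-Re z} / (t+1)` for `t + 1 ≥ v₁`
  have hg_bound : ∀ t : ℝ, v₁ ≤ t + 1 →
      ‖g (t + 1)‖ ≤ 2 * Real.exp (γ * z.re) * (t + 1) ^ (-z.re) / (t + 1) := by
    intro t ht
    have ht0 : 0 < t + 1 := by linarith
    have h := (hGbounds (t + 1) ht).2
    have hnorm : ‖(((t + 1 : ℝ)) : ℂ) * g (t + 1)‖ = (t + 1) * ‖g (t + 1)‖ := by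
      rw [norm_mul, Complex.norm_real, Real.norm_of_nonneg ht0.le]
    push_cast at hnorm h
    rw [hnorm, hEnorm (t + 1) ht0] at h
    rw [le_div_iff₀ ht0]
    linarith
  -- continuity of the row and of `M(t) = ‖K t‖ t^{-Re z}`
  have hKcont : Continuous Kf := by
    have := stub_calculus.2.2.2.2.1 u z
    exact this.comp (continuous_id.add continuous_const)
  set M : ℝ → ℝ := fun t => ‖Kf t‖ * t ^ (-z.re) with hM
  have hMcont : ContinuousOn M (Icc (v₁ - 1) v) := by
    refine (hKcont.norm.continuousOn).mul (ContinuousOn.rpow_const continuousOn_id fun t ht => ?_)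
    left
    exact ne_of_gt (show (0 : ℝ) < t by linarith [ht.1])
  have hM0 : ∀ t ∈ Icc (v₁ - 1) v, 0 ≤ M t := fun t ht =>
    mul_nonneg (norm_nonneg _) (Real.rpow_nonneg (by linarith [ht.1]) _)
  have hMK : ∀ t : ℝ, 0 < t → ‖Kf t‖ = M t * t ^ z.re := by
    intro t ht
    simp only [hM]
    rw [mul_assoc, ← Real.rpow_add ht, neg_add_cancel, Real.rpow_zero, mul_one]
  -- the invariant at `w ∈ [1, v]`
  have hInv : ∀ w : ℝ, 1 ≤ w → w ≤ v →
      Kf w * ((w : ℂ) * g w) + z * ∫ t in (w - 1)..w, Kf t * g (t + 1) =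
        (Complex.Gamma (1 + z))⁻¹ := by
    intro w hw1 hwv
    have h := hConst N hN1 z hzN u hu3 w hw1 (by rw [hv] at hwv; exact hwv)
    rw [hVal N hN1 z hzN] at h
    have h' : (w : ℂ) * Kf w * g w + z * ∫ t in (w - 1)..w, Kf t * g (t + 1) =
        (Complex.Gamma (1 + z))⁻¹ := by
      simpa [hKf, hg] using h
    rw [← h']; ring
  -- the window integral bound
  have hIbound : ∀ w : ℝ, v₁ ≤ w → w ≤ v → ∀ S : ℝ, 0 ≤ S → (∀ t ∈ Icc (w - 1) w, M t ≤ S) →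
      ‖∫ t in (w - 1)..w, Kf t * g (t + 1)‖ ≤ S * (2 * Real.exp (γ * z.re) * 2 ^ (K + 1)) / w := by
    intro w hw hwv S hS0 hS
    have hw0 : 0 < w := by linarith
    have hint : ∀ t ∈ Ι (w - 1) w,
        ‖Kf t * g (t + 1)‖ ≤ S * (2 * Real.exp (γ * z.re) * 2 ^ (K + 1)) / w := by
      intro t ht
      rw [Set.uIoc_of_le (by linarith)] at ht
      have ht1 : (1 : ℝ) ≤ t := by linarith [ht.1]
      have ht0 : 0 < t := by linarith
      rw [norm_mul]
      exact integrand_bound (hMK t ht0) (hS t ⟨ht.1.le, ht.2⟩) (Real.rpow_nonneg ht0.le _)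
        (hg_bound t (by linarith [ht.1])) (norm_nonneg _) (rpow_mul_rpow_neg_succ_le K hreK ht1)
        (Real.exp_pos _).le hS0 hw0 (by linarith) (by linarith [ht.1]) (by positivity)
    have hI := intervalIntegral.norm_integral_le_of_norm_le_const hint
    rwa [show |w - (w - 1)| = 1 by rw [show w - (w - 1) = (1 : ℝ) by ring]; simp, mul_one] at hI
  -- the contracting window estimate
  have hwindow : ∀ w : ℝ, v₁ ≤ w → w ≤ v → ∀ S : ℝ, 0 ≤ S → (∀ t ∈ Icc (w - 1) w, M t ≤ S) →
      M w ≤ A₁ + S / 2 := by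
    intro w hw hwv S hS0 hS
    have hw0 : 0 < w := by linarith
    have h := window_step (hInv w (by linarith) hwv) (hCΓ z hzR) (hIbound w hw hwv S hS0 hS) hzR
      (hGbounds w hw).1 (hEnorm w hw0) hea hCΓ0
    rw [← hC₂, ← hA₁] at h
    have hcs : 2 * C₂ / w * S ≤ 1 / 2 * S := by
      apply mul_le_mul_of_nonneg_right _ hS0
      rw [div_le_iff₀ hw0]; linarith
    calc M w = ‖Kf w‖ * w ^ (-z.re) := rfl
      _ ≤ A₁ + 2 * C₂ / w * S := h
      _ ≤ A₁ + 1 / 2 * S := by linarith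
      _ = A₁ + S / 2 := by ring
  -- the initial window: the crude bound `M ≤ B₀` on `[v₁ - 1, v₁]`
  have h0 : ∀ x ∈ Icc (v₁ - 1) v₁, M x ≤ B₀ := fun x hx =>
    rowFn_weighted_le u z hzR hre1 (by linarith) hx
  -- (i) the a-priori bound
  have hMbound : ∀ t ∈ Icc (v₁ - 1) v, M t ≤ Abig := apriori_bound hA₁0 hMcont hM0 h0 hwindow
  -- (ii) the final division at `w = v`, and conversion to the statement
  have hvge : v₁ ≤ v := by linarith
  have hI := hIbound v hvge le_rfl Abig hAbig0 (fun t ht => hMbound t ⟨by linarith [ht.1], ht.2⟩)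
  have hfin := final_step hv0 (hInv v hv1 le_rfl) (hCΓ z hzR) hI hzR (hWat v hvge) (hGbounds v hvge).1
    (hEnorm v hv0) hea hCΓ0 hC₁0
  rw [← hC₂] at hfin
  exact modGamma_convert u z (by linarith) hCfin0 hfin

end Summit.Parity.GeneralizedHardyLittlewood.Cruxes.AbsoluteUpgrade.DipMarginRateExchange

end
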